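import Summits.QuantumFields.YangMills.Theorems.FemtoTransferGapGroundState
import Literature.Analysis.OperatorTheory.PositiveKernelGroundStateUniqueness
import HarnessLib

/-!
# (B-ST) step (E): THE TOP VALUE BOUNDS THE TRANSFER FORM OF EVERY BOUNDED MEASURABLE FUNCTION — `⟨ψ, K_β ψ⟩ ≤ λ₀(β,L)·‖ψ‖²` WITHOUT gauge or twist invariance
# (lane A of S-BASE, crux `TwistedTraceScaling` stmt-QuantumFields-20203, C4-CORE, the (B-ST) pen; design card `pub/ym-fleet/ym-luscher-20007-p1/Lines-BST-poincare.md` (E))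

The tree's `topValue ρ L β` (`= levelValue ρ L β 0`) is the supremum of Rayleigh quotients over PHYSICAL (gauge- and twist-invariant) test functions, and the trial-function door
`rayleigh_le_topValue` needs `IsPhys`.  In the stiff brick (B-ST) the slow factor of a general tube state `v` is NOT physical (the colour-charged first stiff excitation
`n(u)·z_a(x)·Ω_c` of `…Negative.StiffGapCeiling` R60 (i) has its slow amplitude in the adjoint sector), and the only bound the (OD) pen had there, `linkCE ≤ 2λ₀`, loses a factor
`2` — fatal for a gap.  Perron–Frobenius closes it exactly: `…FemtoTransferGapGroundState.exists_groundState` (Jentzsch) gives an everywhere-positive physical `Ω` with `K_βΩ = λ₀Ω`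
POINTWISE, and Lit `PositiveKernelGroundState.integral_integral_le_eigenvalue_mul` (Reed–Simon IV, XIII.44) says a positive pointwise eigenfunction dominates the Rayleigh quotient of EVERY
bounded measurable function.
* ★★ `qform_le_topValue_mul_l2_of_bdd` — `qform su2Rep β ψ ψ ≤ topValue su2Rep L β * l2 ψ ψ` for all bounded measurable `ψ`, every `L ≥ 1`, every real `β`;
* ★★ `qform_le_levelValue_zero_mul_l2_of_bdd` — the same with `levelValue su2Rep L β 0`;
* ★ `integral_integral_transferKernel_le_topValue` — kernel form: `∫∫ a(u)K_β(u,u')a(u') ≤ λ₀·∫ a²` (the shape used for the slow factor `a(u) = ‖v_u‖_{fibre}` after the fibre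
  Cauchy–Schwarz of the (B-ST) chain, at `L := 1`, `β := L³β`).
HONEST FRAMING: a corollary of landed Perron–Frobenius results; (B-ST) OPEN; C4-CORE OPEN; not infinite volume, not a gap, not Clay.
-/

set_option autoImplicit false

noncomputable section

open MeasureTheory Filter Topology Real
open Literature.MathematicalPhysics.QuantumFieldTheory
open Literature.MathematicalPhysics.QuantumLattice
open Literature.Analysis.OperatorTheory

namespace Summit.QuantumFields.YangMills.Theorems.FemtoTransferGap.PhysL2

open Summit.QuantumFields.YangMills.Theorems.FemtoTransferGap

variable {L : ℕ} [NeZero L]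

/-- ★ **Kernel form**: `∫∫ ψ(U)K_β(U,V)ψ(V) ≤ λ₀(β,L)·∫ ψ²` for every bounded measurable `ψ` (no invariance asked). [cite: ReedSimonIV1978, Thm XIII.44] -/
theorem integral_integral_transferKernel_le_topValue (β : ℝ) {ψ : GaugeConfig 3 L SU2 → ℝ} (hψm : Measurable ψ) {M : ℝ} (hψb : ∀ U, |ψ U| ≤ M) :
    ∫ U, ∫ V, ψ U * transferKernel su2Rep β U V * ψ V ∂configMeasure SU2 L ∂configMeasure SU2 L ≤ topValue su2Rep L β * ∫ U, ψ U ^ 2 ∂configMeasure SU2 L := by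
  obtain ⟨Ω, θ, c, hΩ, hc, hcle, -, heig, -, -, -⟩ := exists_groundState (L := L) β
  obtain ⟨C, hC0, hC⟩ := exists_norm_transferKernel_le (L := L) β
  obtain ⟨B, hB⟩ := hΩ.bounded
  have hμ : (configMeasure SU2 L) ≠ 0 := IsProbabilityMeasure.ne_zero _
  have hpos : ∀ U, 0 < Ω U := fun U => hc.trans_le (hcle U)
  have he : ∀ U, ∫ V, transferKernel su2Rep β U V * Ω V ∂configMeasure SU2 L = topValue su2Rep L β * Ω U := fun U => by
    have h := congrFun heig U
    rw [transferApply_apply] at h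
    simpa using h
  exact PositiveKernelGroundState.integral_integral_le_eigenvalue_mul (μ := configMeasure SU2 L) (stronglyMeasurable_transferKernel β) hC
    (transferKernel_su2Rep_symm β) (fun U V => transferKernel_pos su2Rep β U V) hμ hΩ.measurable hpos (B := B) (fun U => by rw [Real.norm_eq_abs]; exact hB U) he
    hψm (M := M) fun U => by rw [Real.norm_eq_abs]; exact hψb U

/-- ★★ **`⟨ψ, K_β ψ⟩ ≤ λ₀(β,L)·‖ψ‖²` for EVERY bounded measurable `ψ`** (Perron–Frobenius; no gauge or twist invariance). [cite: ReedSimonIV1978, Thm XIII.44] -/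
theorem qform_le_topValue_mul_l2_of_bdd (β : ℝ) {ψ : GaugeConfig 3 L SU2 → ℝ} (hψm : Measurable ψ) {M : ℝ} (hψb : ∀ U, |ψ U| ≤ M) :
    qform su2Rep β ψ ψ ≤ topValue su2Rep L β * l2 ψ ψ := by
  have h := integral_integral_transferKernel_le_topValue β hψm hψb
  have e : l2 ψ ψ = ∫ U, ψ U ^ 2 ∂configMeasure SU2 L := integral_congr_ae (ae_of_all _ fun U => by ring)
  unfold qform
  rw [e]
  exact h

/-- ★★ The same with `levelValue … 0`. [cite: ReedSimonIV1978, Thm XIII.44] -/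
theorem qform_le_levelValue_zero_mul_l2_of_bdd (β : ℝ) {ψ : GaugeConfig 3 L SU2 → ℝ} (hψm : Measurable ψ) {M : ℝ} (hψb : ∀ U, |ψ U| ≤ M) :
    qform su2Rep β ψ ψ ≤ levelValue su2Rep L β 0 * l2 ψ ψ := by
  rw [levelValue_zero]
  exact qform_le_topValue_mul_l2_of_bdd β hψm hψb

end Summit.QuantumFields.YangMills.Theorems.FemtoTransferGap.PhysL2

end
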